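/-
Copyright (c) 2026. All rights reserved.
Released under Apache 2.0 license as described in the file LICENSE.
Authors: abc-iut cell, Cor. 3.12 sub-crew seat abc-iut-c312-3 (gen 10), over abc-iut-s2-p12's
`UnitLogInnerRadiusTieTorsion*` and abc-iut-w5-d039's `TorsionUnits` / `UnitLogBallTorsionCensus`.
-/
import Literature.IUT.LogVolume.UnitLogInnerRadiusTieTorsionFill
import Literature.IUT.LogVolume.UnitLogBallTorsionCensus
import HarnessLib

/-!
# The inner radius at a TIE index `e = A·(p−1)`, IIId: the torsion witness in GENERATOR NORMAL FORM,
# and the arithmetic obstruction `ζ_{p^{k+1}} ∈ K ∧ p^{k+1} ∤ A ⇒ r_in = A + 1`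

Proof-only sequel (theorems, no definitions, no named fact) of abc-iut-s2-p12's
`UnitLogInnerRadiusTieTorsion.lean` / `…Witness.lean` / `…Fill.lean`, which decide the critical ball at a
tie index by a TORSION WITNESS: for `p` odd, `e = absRamificationIdx p K = A·(p−1)` (ANY `A`) and `ζ_p ∈ K`,
`{‖z‖ ≤ ‖ϖ‖^A} ⊆ log_p(𝒪_K^×) ⟺ ∃ ζ' u, ζ' ∈ μ(K) ∖ K^p ∧ ‖u^p − ζ'‖ ≤ ‖p‖·‖ϖ‖^A`
(`closedBall_level_subset_logUnits_iff_torsionWitness`).  Setting as there: `K` a proper ultrametric normed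
`ℚ_p`-algebra field, `p` ODD, `ϖ` a norm uniformizer, `Λ := log_p(𝒪_K^×) = logUnits K`.

HERE the existential quantifier over `μ(K) ∖ K^p` is removed:

* (§1, used inline: `x ↦ x^n` is `1`-Lipschitz on the closed unit ball of an ultrametric field — the tree's
  `Literature.NumberTheory.EllipticCurves.norm_pow_sub_pow_le`, re-proved in two lines where needed rather than
  importing the elliptic-curve stack into `LogVolume`.)
* §2 `exists_pow_prime_eq_of_pow_prime_eq_pow_coprime`: if `ζ^{n'}` (`p ∤ n'`) is a `p`-th power then so is
  `ζ` (Bezout); hence a torsion witness may always be taken with `ζ'` of `p`-POWER order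
  (`exists_ppow_torsionWitness_of_torsionWitness`: replace `(ζ', u)` by `(ζ'^{n'}, u^{n'})`).
* §3 `exists_eq_pow_mul_pow_prime`: for `p`-power roots of unity `ξ`, `ζ` of `K` with `ζ ∉ K^p`, `ξ = ζ^i·θ^p`
  — the finite group `rootsOfUnity N K` is CYCLIC (Mathlib), `ζ = g^b` with `p ∤ b`, invert `b` modulo `p`.
  Consequently **THE GENERATOR NORMAL FORM** (`exists_torsionWitness_iff_generator`): for ANY `p`-power root
  of unity `ξ ∈ K` which is not a `p`-th power in `K` (equivalently: a generator of `μ_{p^∞}(K)`),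
  `(∃ torsion witness) ⟺ ∃ u, ‖u^p − ξ‖ ≤ ‖p‖·‖ϖ‖^A`, and so (`closedBall_level_subset_logUnits_iff_generator`)
  **`{‖z‖ ≤ ‖ϖ‖^A} ⊆ log_p(𝒪_K^×) ⟺ ∃ u ∈ K, ‖u^p − ξ‖ ≤ ‖p‖·‖ϖ‖^A`** — ONE congruence on ONE element
  (classically: `ξ = ζ_{p^m}` is a `p`-th power modulo `U^{(pe/(p−1))}`, i.e. `K(ζ_{p^{m+1}})/K` unramified).
* §4 **`pow_succ_dvd_level_of_torsionWitness`**: if `ξ` is a PRIMITIVE `p^{k+1}`-th root of unity, not a `p`-th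
  power in `K`, and a torsion witness exists, then **`p^{k+1} ∣ A`** (`ξ` has level `A/p^k` by abc-iut-w5-d039's
  `‖1 − ξ‖^{p^k(p−1)} = ‖p‖`; the `u` of §3 is a principal unit of level `t < A` with EXACT `p`-th power,
  `p·t = A/p^k`).  For `k = 0` this is abc-iut-s2-p12's `dvd_level_of_torsionWitness_of_pow_prime_eq_one`.
  R-W format (`innerRadius_tie_succ_of_not_pow_succ_dvd`): **`p^{k+1} ∤ A ⇒ r_in = A + 1`**, i.e.
  `closedBall 0 ‖ϖ‖^{A+1} ⊆ logUnits K ∧ ¬ closedBall 0 ‖ϖ‖^A ⊆ logUnits K` — decided by `(e, #μ_{p^∞}(K))` alone.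
* Sequel `UnitLogInnerRadiusTieTorsionObstruction.lean`: the same packaged over `m := torsionPExp p K`
  (abc-iut-w5-d039: `#R^μ = p^m·(p^f − 1)`) — `p^m ∤ A ⇒ r_in = A + 1`, and the criterion at a generator of `μ_{p^∞}(K)`.

References: [cite: SerreLocalFields1979, Ch. XIV §4] [cite: NeukirchANT1999, Ch. II Prop. (5.5)–(5.7), (7.13)]
[cite: Washington1997, Lemma 1.4, §5.1].  Classical `p`-adic analysis; `logUnits` is the cell's typing of
[IUTchIV] Prop. 1.2's `log_p(R^×)` ([claim: Mochizuki2012, status: disputed] for that locution only).  Consumer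
(record only): D-0079 R-W lane U column «rho_in» at tie places with `p ∣ A` and `ζ_p ∈ K_w`.  Nothing here is
disputed mathematics; no IUT statement is asserted; nothing bears on [IUTchIII] Cor. 3.12.
-/

noncomputable section

open Metric Set IsUltrametricDist IsLocalRing
open scoped NormedField

namespace Literature.IUT.LogVolume

open Literature.NumberTheory.GaloisRepresentations.Ultrametric BoundaryRamification

namespace LogEnvelope

/-! ### §2. Reduction of a torsion witness to `p`-power order -/

section Algebra

variable (p : ℕ) [hp : Fact p.Prime] {K : Type*} [Field K]

/-- **Bezout**: if `η^p = ζ^{n'}` with `p ∤ n'` (`ζ ≠ 0`) then `ζ` itself is a `p`-th power (`n'·α = p·t + 1`,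
`ζ = (η^α/ζ^t)^p`). [cite: SerreLocalFields1979, Ch. XIV §4] -/
theorem exists_pow_prime_eq_of_pow_prime_eq_pow_coprime {ζ η : K} {n' : ℕ} (hζ0 : ζ ≠ 0) (hn' : ¬ p ∣ n')
    (hη : η ^ p = ζ ^ n') : ∃ θ : K, θ ^ p = ζ := by
  have hcop : Nat.Coprime n' p := Nat.coprime_comm.mp ((Nat.Prime.coprime_iff_not_dvd hp.out).mpr hn')
  obtain ⟨α, -, hα⟩ := Nat.exists_mul_mod_eq_one_of_coprime hcop hp.out.one_lt
  have hnα : n' * α = p * (n' * α / p) + 1 := by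
    have h := Nat.div_add_mod (n' * α) p
    rw [hα] at h
    exact h.symm
  set t : ℕ := n' * α / p with ht
  refine ⟨η ^ α * (ζ ^ t)⁻¹, ?_⟩
  have hζt : ζ ^ (p * t) ≠ 0 := pow_ne_zero _ hζ0
  rw [mul_pow, ← pow_mul, mul_comm α p, pow_mul, hη, ← pow_mul, hnα, pow_succ, inv_pow, ← pow_mul,
    mul_comm t p, mul_comm (ζ ^ (p * t)) ζ, mul_assoc, mul_inv_cancel₀ hζt, mul_one]

/-- **In the cyclic group of `p`-power roots of unity**: if `ξ^{p^j} = 1`, `ζ^{p^k} = 1` and `ζ` is NOT a `p`-th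
power in `K`, then `ξ = ζ^i · θ^p` for some `i ∈ ℕ`, `θ ∈ K^×` (`rootsOfUnity N K` is cyclic with generator `g`;
`ζ = g^b` with `p ∤ b`, `ξ = g^a`; take `i = i₀·a` with `b·i₀ ≡ 1 (mod p)`). [cite: SerreLocalFields1979, Ch. XIV §4] -/
theorem exists_eq_pow_mul_pow_prime {ξ ζ : K} {j k : ℕ} (hξ : ξ ^ p ^ j = 1) (hζ : ζ ^ p ^ k = 1)
    (hζnot : ∀ η : K, η ^ p ≠ ζ) : ∃ (i : ℕ) (θ : K), θ ≠ 0 ∧ ξ = ζ ^ i * θ ^ p := by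
  classical
  set N : ℕ := p ^ j * p ^ k with hN
  have hN0 : N ≠ 0 := mul_ne_zero (pow_ne_zero _ hp.out.ne_zero) (pow_ne_zero _ hp.out.ne_zero)
  haveI : NeZero N := ⟨hN0⟩
  have hξN : ξ ^ N = 1 := by rw [hN, pow_mul, hξ, one_pow]
  have hζN : ζ ^ N = 1 := by rw [hN, mul_comm, pow_mul, hζ, one_pow]
  have hξ0 : ξ ≠ 0 := fun h => by rw [h, zero_pow hN0] at hξN; exact zero_ne_one hξN
  have hζ0 : ζ ≠ 0 := fun h => by rw [h, zero_pow hN0] at hζN; exact zero_ne_one hζN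
  set ξu : Kˣ := Units.mk0 ξ hξ0 with hξu_def
  set ζu : Kˣ := Units.mk0 ζ hζ0 with hζu_def
  have hξu : ξu ∈ rootsOfUnity N K := by
    rw [mem_rootsOfUnity]; ext; rw [Units.val_pow_eq_pow_val, hξu_def, Units.val_mk0, hξN, Units.val_one]
  have hζu : ζu ∈ rootsOfUnity N K := by
    rw [mem_rootsOfUnity]; ext; rw [Units.val_pow_eq_pow_val, hζu_def, Units.val_mk0, hζN, Units.val_one]
  obtain ⟨g, hg⟩ := IsCyclic.exists_generator (α := rootsOfUnity N K)
  have hpow : ∀ x : rootsOfUnity N K, ∃ n : ℕ, g ^ n = x := fun x =>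
    (Submonoid.mem_powers_iff _ _).mp (mem_powers_iff_mem_zpowers.mpr (hg x))
  obtain ⟨a, ha⟩ := hpow ⟨ξu, hξu⟩
  obtain ⟨b, hb⟩ := hpow ⟨ζu, hζu⟩
  set γ : K := ((g : Kˣ) : K) with hγ_def
  have hγ0 : γ ≠ 0 := (g : Kˣ).ne_zero
  have hγa : γ ^ a = ξ := by
    have h := congrArg (fun x : rootsOfUnity N K => ((x : Kˣ) : K)) ha
    simpa [hγ_def, Units.val_pow_eq_pow_val, hξu_def] using h
  have hγb : γ ^ b = ζ := by
    have h := congrArg (fun x : rootsOfUnity N K => ((x : Kˣ) : K)) hb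
    simpa [hγ_def, Units.val_pow_eq_pow_val, hζu_def] using h
  -- `p ∤ b`
  have hpb : ¬ p ∣ b := by
    rintro ⟨c, hc⟩
    refine hζnot (γ ^ c) ?_
    rw [← pow_mul, mul_comm, ← hc, hγb]
  -- invert `b` modulo `p`
  have hcop : Nat.Coprime b p := Nat.coprime_comm.mp ((Nat.Prime.coprime_iff_not_dvd hp.out).mpr hpb)
  obtain ⟨i₀, -, hi₀⟩ := Nat.exists_mul_mod_eq_one_of_coprime hcop hp.out.one_lt
  have hbi₀ : b * i₀ = p * (b * i₀ / p) + 1 := by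
    have h := Nat.div_add_mod (b * i₀) p
    rw [hi₀] at h
    exact h.symm
  set t : ℕ := b * i₀ / p with ht
  refine ⟨i₀ * a, (γ ^ (t * a))⁻¹, inv_ne_zero (pow_ne_zero _ hγ0), ?_⟩
  have hexp : b * (i₀ * a) = t * a * p + a := by
    rw [← mul_assoc, hbi₀]; ring
  have hγt : γ ^ (t * a * p) ≠ 0 := pow_ne_zero _ hγ0
  rw [← hγb, ← pow_mul, inv_pow, ← pow_mul, hexp, pow_add, mul_comm (γ ^ (t * a * p)) (γ ^ a), mul_assoc,
    mul_inv_cancel₀ hγt, mul_one, hγa]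

end Algebra

section Field

variable (p : ℕ) [hp : Fact p.Prime]
variable {K : Type*} [NontriviallyNormedField K] [instK : NormedAlgebra ℚ_[p] K] [IsUltrametricDist K]
  [ProperSpace K]
variable {ϖ : Kˣ} (hϖ : IsUniformizer ϖ) {A : ℕ} (hA : absRamificationIdx p K = A * (p - 1))

omit instK [ProperSpace K] in
/-- **A torsion witness may be taken of `p`-POWER order**: from `(ζ', u)` with `ζ'^n = 1` pass to
`(ζ'^{n'}, u^{n'})`, `n = p^k·n'`, `p ∤ n'` — the congruence survives (§1) and `ζ'^{n'}` is still not a `p`-th power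
(§2). [cite: SerreLocalFields1979, Ch. XIV §4] -/
theorem exists_ppow_torsionWitness_of_torsionWitness {r : ℝ} {ζ' u : K} {n : ℕ} (hn : 0 < n) (hζ' : ζ' ^ n = 1)
    (hnot : ∀ η : K, η ^ p ≠ ζ') (hu : ‖u ^ p - ζ'‖ ≤ r) (hr : r < 1) :
    ∃ (ζ'' u'' : K) (k : ℕ), ζ'' ^ p ^ k = 1 ∧ (∀ η : K, η ^ p ≠ ζ'') ∧ ‖u'' ^ p - ζ''‖ ≤ r := by
  obtain ⟨k, n', hn', hnk⟩ := Nat.exists_eq_pow_mul_and_not_dvd hn.ne' p hp.out.ne_one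
  have hζ'1 : ‖ζ'‖ = 1 := by
    have h := congrArg norm hζ'
    rw [norm_pow, norm_one] at h
    exact (pow_eq_one_iff_of_nonneg (norm_nonneg _) hn.ne').mp h
  have hζ'0 : ζ' ≠ 0 := norm_pos_iff.mp (by rw [hζ'1]; exact one_pos)
  have hup1 : ‖u ^ p‖ ≤ 1 := by
    have h : u ^ p = (u ^ p - ζ') + ζ' := by ring
    rw [h]
    exact (norm_add_le_max _ _).trans (max_le (hu.trans hr.le) hζ'1.le)
  -- `x ↦ x^i` is `1`-Lipschitz on the closed unit ball (cf. `Literature.NumberTheory.EllipticCurves.norm_pow_sub_pow_le`)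
  have hlip : ∀ {x y : K}, ‖x‖ ≤ 1 → ‖y‖ ≤ 1 → ∀ i : ℕ, ‖x ^ i - y ^ i‖ ≤ ‖x - y‖ := by
    intro x y hx hy i
    induction i with
    | zero => simp
    | succ i ih =>
      have h : x ^ (i + 1) - y ^ (i + 1) = x * (x ^ i - y ^ i) + (x - y) * y ^ i := by ring
      rw [h]
      refine (norm_add_le_max _ _).trans (max_le ?_ ?_)
      · rw [norm_mul]; exact (mul_le_of_le_one_left (norm_nonneg _) hx).trans ih
      · rw [norm_mul, norm_pow]
        exact mul_le_of_le_one_right (norm_nonneg _) (pow_le_one₀ (norm_nonneg _) hy)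
  refine ⟨ζ' ^ n', u ^ n', k, ?_, fun η hη => ?_, ?_⟩
  · rw [← pow_mul, mul_comm, ← hnk, hζ']
  · obtain ⟨θ, hθ⟩ := exists_pow_prime_eq_of_pow_prime_eq_pow_coprime p hζ'0 hn' hη
    exact hnot θ hθ
  · rw [← pow_mul, mul_comm, pow_mul]
    exact (hlip hup1 hζ'1.le n').trans hu

include hϖ hA

/-! ### §3. The generator normal form of the torsion witness -/

/-- **Transfer of a torsion witness to ANY `p`-power root of unity `ξ`**: a torsion witness `(ζ', u)` yields `u'`
with `‖u'^p − ξ‖ ≤ ‖p‖·‖ϖ‖^A` (reduce `ζ'` to `p`-power order, write `ξ = ζ'^i·θ^p` in the cyclic group of `p`-power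
roots of unity — possible because `ζ'` is not a `p`-th power — and take `u' := u^i·θ`).  So if the critical ball
lies in `log_p(𝒪_K^×)`, EVERY `p`-power root of unity of `K` is a `p`-th power modulo `‖p‖·𝔪^A`.
[cite: SerreLocalFields1979, Ch. XIV §4] -/
theorem exists_norm_pow_sub_generator_le_of_torsionWitness {ξ : K} {j : ℕ} (hξ : ξ ^ p ^ j = 1)
    {ζ' u : K} {n : ℕ} (hn : 0 < n) (hζ' : ζ' ^ n = 1)
    (hnot : ∀ η : K, η ^ p ≠ ζ') (hu : ‖u ^ p - ζ'‖ ≤ ‖(p : K)‖ * ‖(ϖ : K)‖ ^ A) :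
    ∃ u' : K, ‖u' ^ p - ξ‖ ≤ ‖(p : K)‖ * ‖(ϖ : K)‖ ^ A := by
  have hr1 := norm_prime_mul_pow_level_lt_one p hϖ hA
  obtain ⟨ζ'', u'', k, hζ'', hnot'', hu''⟩ :=
    exists_ppow_torsionWitness_of_torsionWitness p hn hζ' hnot hu hr1
  -- `ζ''` is a `p`-power root of unity, not a `p`-th power: `ξ = ζ''^i · θ^p`
  obtain ⟨i, θ, -, hξeq⟩ := exists_eq_pow_mul_pow_prime p hξ hζ'' hnot''
  have hζ''1 : ‖ζ''‖ = 1 := by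
    have hk0 : p ^ k ≠ 0 := pow_ne_zero _ hp.out.ne_zero
    have h := congrArg norm hζ''
    rw [norm_pow, norm_one] at h
    exact (pow_eq_one_iff_of_nonneg (norm_nonneg _) hk0).mp h
  have hup1 : ‖u'' ^ p‖ ≤ 1 := by
    have h : u'' ^ p = (u'' ^ p - ζ'') + ζ'' := by ring
    rw [h]
    exact (norm_add_le_max _ _).trans (max_le (hu''.trans hr1.le) hζ''1.le)
  -- `‖θ‖ = 1`: `‖ξ‖ = 1 = ‖ζ''^i‖`
  have hξ1 : ‖ξ‖ = 1 := by
    have hj0 : p ^ j ≠ 0 := pow_ne_zero _ hp.out.ne_zero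
    have h := congrArg norm hξ
    rw [norm_pow, norm_one] at h
    exact (pow_eq_one_iff_of_nonneg (norm_nonneg _) hj0).mp h
  have hθp1 : ‖θ ^ p‖ = 1 := by
    have h := congrArg norm hξeq
    rw [hξ1, norm_mul, norm_pow, hζ''1, one_pow, one_mul] at h
    exact h.symm
  -- `x ↦ x^i` is `1`-Lipschitz on the closed unit ball (cf. `Literature.NumberTheory.EllipticCurves.norm_pow_sub_pow_le`)
  have hlip : ∀ {x y : K}, ‖x‖ ≤ 1 → ‖y‖ ≤ 1 → ∀ i : ℕ, ‖x ^ i - y ^ i‖ ≤ ‖x - y‖ := by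
    intro x y hx hy i
    induction i with
    | zero => simp
    | succ i ih =>
      have h : x ^ (i + 1) - y ^ (i + 1) = x * (x ^ i - y ^ i) + (x - y) * y ^ i := by ring
      rw [h]
      refine (norm_add_le_max _ _).trans (max_le ?_ ?_)
      · rw [norm_mul]; exact (mul_le_of_le_one_left (norm_nonneg _) hx).trans ih
      · rw [norm_mul, norm_pow]
        exact mul_le_of_le_one_right (norm_nonneg _) (pow_le_one₀ (norm_nonneg _) hy)
  refine ⟨u'' ^ i * θ, ?_⟩
  calc ‖(u'' ^ i * θ) ^ p - ξ‖ = ‖((u'' ^ p) ^ i - ζ'' ^ i) * θ ^ p‖ := by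
        rw [hξeq, mul_pow, ← pow_mul, mul_comm i p, pow_mul]; ring_nf
    _ = ‖(u'' ^ p) ^ i - ζ'' ^ i‖ := by rw [norm_mul, hθp1, mul_one]
    _ ≤ ‖u'' ^ p - ζ''‖ := hlip hup1 hζ''1.le i
    _ ≤ ‖(p : K)‖ * ‖(ϖ : K)‖ ^ A := hu''

/-- **THE GENERATOR NORMAL FORM of the torsion witness** (`p` prime, `e = A(p−1)`): for ANY `p`-power root of
unity `ξ ∈ K` which is not a `p`-th power in `K` (equivalently, a generator of `μ_{p^∞}(K)`), a torsion witness
exists iff **`‖u^p − ξ‖ ≤ ‖p‖·‖ϖ‖^A` for some `u ∈ K`**. [cite: SerreLocalFields1979, Ch. XIV §4] -/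
theorem exists_torsionWitness_iff_generator {ξ : K} {j : ℕ} (hξ : ξ ^ p ^ j = 1) (hξnot : ∀ η : K, η ^ p ≠ ξ) :
    (∃ ζ' u : K, (∃ n : ℕ, 0 < n ∧ ζ' ^ n = 1) ∧ (∀ η : K, η ^ p ≠ ζ') ∧
        ‖u ^ p - ζ'‖ ≤ ‖(p : K)‖ * ‖(ϖ : K)‖ ^ A) ↔
      ∃ u : K, ‖u ^ p - ξ‖ ≤ ‖(p : K)‖ * ‖(ϖ : K)‖ ^ A := by
  constructor
  · rintro ⟨ζ', u, ⟨n, hn, hζ'⟩, hnot, hu⟩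
    exact exists_norm_pow_sub_generator_le_of_torsionWitness p hϖ hA hξ hn hζ' hnot hu
  · rintro ⟨u, hu⟩
    exact ⟨ξ, u, ⟨p ^ j, pow_pos hp.out.pos _, hξ⟩, hξnot, hu⟩

omit hϖ hA in
omit hp instK [IsUltrametricDist K] [ProperSpace K] in
/-- A `p`-power root of unity `ξ ≠ 1` has a power which is a NON-TRIVIAL `p`-th root of unity (`ξ^{p^t}` for the
largest `t` with `ξ^{p^t} ≠ 1`). [cite: NeukirchANT1999, Ch. II (7.13)] -/
theorem exists_pow_prime_eq_one_ne_one_of_ppow {ξ : K} {j : ℕ} (hξ : ξ ^ p ^ j = 1) (hξ1 : ξ ≠ 1) :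
    ∃ ζ : K, ζ ^ p = 1 ∧ ζ ≠ 1 := by
  classical
  have hex : ∃ t : ℕ, ξ ^ p ^ t = 1 := ⟨j, hξ⟩
  set t₀ := Nat.find hex with ht₀
  have ht₀spec : ξ ^ p ^ t₀ = 1 := Nat.find_spec hex
  have ht₀pos : t₀ ≠ 0 := by
    intro h
    rw [h, pow_zero, pow_one] at ht₀spec
    exact hξ1 ht₀spec
  obtain ⟨s, hs⟩ := Nat.exists_eq_add_one_of_ne_zero ht₀pos
  refine ⟨ξ ^ p ^ s, ?_, ?_⟩
  · rw [← pow_mul, ← pow_succ, ← hs, ht₀spec]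
  · have hlt : s < t₀ := by omega
    exact Nat.find_min hex (by rw [← ht₀]; exact hlt)

/-- **THE CRITICAL BALL DECIDED BY ONE CONGRUENCE** (`p` odd, `e = A(p−1)`, ANY `A`): if `ξ ∈ K` is a `p`-power
root of unity which is not a `p`-th power in `K` (a generator of `μ_{p^∞}(K)`; its existence says `ζ_p ∈ K`),
then **`{‖z‖ ≤ ‖ϖ‖^A} ⊆ log_p(𝒪_K^×) ⟺ ∃ u ∈ K, ‖u^p − ξ‖ ≤ ‖p‖·‖ϖ‖^A`** (abc-iut-s2-p12's criterion in
generator normal form; classically: iff `K(ξ^{1/p})/K` is unramified). [cite: SerreLocalFields1979, Ch. XIV §4]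
[cite: NeukirchANT1999, Ch. II Prop. (5.5)–(5.7)] -/
theorem closedBall_level_subset_logUnits_iff_generator (hp2 : p ≠ 2) {ξ : K} {j : ℕ} (hξ : ξ ^ p ^ j = 1)
    (hξnot : ∀ η : K, η ^ p ≠ ξ) :
    closedBall (0 : K) (‖(ϖ : K)‖ ^ A) ⊆ logUnits K ↔ ∃ u : K, ‖u ^ p - ξ‖ ≤ ‖(p : K)‖ * ‖(ϖ : K)‖ ^ A := by
  have hξ1 : ξ ≠ 1 := fun h => hξnot 1 (by rw [one_pow, h])
  obtain ⟨ζ, hζ, hζ1⟩ := exists_pow_prime_eq_one_ne_one_of_ppow p hξ hξ1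
  rw [closedBall_level_subset_logUnits_iff_torsionWitness p hϖ hA hp2 hζ hζ1]
  exact exists_torsionWitness_iff_generator p hϖ hA hξ hξnot

/-! ### §4. A torsion witness forces `p^{k+1} ∣ A` when `ζ_{p^{k+1}} ∈ K` generates -/

/-- **A primitive `p^{k+1}`-th root of unity has level `A/p^k`**: `‖1 − ξ‖^{p^k} = ‖ϖ‖^A` (abc-iut-w5-d039:
`‖1 − ξ‖^{p^k(p−1)} = ‖p‖ = ‖ϖ‖^{A(p−1)}`). [cite: NeukirchANT1999, Ch. II (7.13)] -/
theorem norm_one_sub_pow_eq_of_isPrimitiveRoot {ξ : K} {k : ℕ} (hξ : IsPrimitiveRoot ξ (p ^ (k + 1))) :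
    ‖1 - ξ‖ ^ p ^ k = ‖(ϖ : K)‖ ^ A := by
  have h := norm_one_sub_pow_eq_norm_prime_of_isPrimitiveRoot_pow p K hξ
  rw [norm_prime_eq_norm_pow p K hϖ, hA, pow_mul, pow_mul] at h
  have hq0 : p - 1 ≠ 0 := by have := hp.out.two_le; omega
  exact (pow_left_inj₀ (pow_nonneg (norm_nonneg _) _) (pow_nonneg (norm_nonneg _) _) hq0).mp h

/-- **A torsion witness forces `p^{k+1} ∣ A` whenever `K` contains a PRIMITIVE `p^{k+1}`-th root of unity `ξ`**
(`p` prime, `e = A(p−1)`; no condition on `ξ` beyond primitivity): by §3 `‖v^p − ξ‖ ≤ ‖p‖·‖ϖ‖^A` for some `v`, so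
`v` is a principal unit with `‖1 − v^p‖ = ‖1 − ξ‖ = ‖ϖ‖^{A/p^k}`; level `≥ A` would give `‖1 − v^p‖ ≤ ‖ϖ‖^{Ap}`, so the
`p`-th power is EXACT (abc-iut-s2-p12) and `A/p^k = p·level(v)`.  For `k = 0` compare abc-iut-s2-p12's
`dvd_level_of_torsionWitness_of_pow_prime_eq_one`. [cite: SerreLocalFields1979, Ch. XIV §4]
[cite: NeukirchANT1999, Ch. II (5.5), (7.13)] -/
theorem pow_succ_dvd_level_of_torsionWitness {ξ : K} {k : ℕ} (hξ : IsPrimitiveRoot ξ (p ^ (k + 1)))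
    {ζ' u : K} {n : ℕ} (hn : 0 < n) (hζ' : ζ' ^ n = 1)
    (hnot : ∀ η : K, η ^ p ≠ ζ') (hu : ‖u ^ p - ζ'‖ ≤ ‖(p : K)‖ * ‖(ϖ : K)‖ ^ A) : p ^ (k + 1) ∣ A := by
  have hρ0 : 0 < ‖(ϖ : K)‖ := norm_units_pos ϖ
  have hA1 := one_le_level p hA
  have hP2 := hp.out.two_le
  obtain ⟨v, hv⟩ := exists_norm_pow_sub_generator_le_of_torsionWitness p hϖ hA hξ.pow_eq_one hn hζ' hnot hu
  -- the level `ℓ` of `ξ`: `‖1 − ξ‖ = ‖ϖ‖^ℓ` with `ℓ·p^k = A`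
  have hone : 1 < p ^ (k + 1) := Nat.one_lt_pow (Nat.succ_ne_zero k) hp.out.one_lt
  have hξ1 : ξ ≠ 1 := hξ.ne_one hone
  have hx : (1 : K) - ξ ≠ 0 := sub_ne_zero.mpr (Ne.symm hξ1)
  obtain ⟨ℓ, hℓ⟩ := hϖ.2 (Units.mk0 (1 - ξ) hx)
  rw [Units.val_mk0] at hℓ
  have hlev := norm_one_sub_pow_eq_of_isPrimitiveRoot p hϖ hA hξ
  have hℓA : ℓ * ((p ^ k : ℕ) : ℤ) = (A : ℤ) := by
    rw [hℓ, ← zpow_natCast, ← zpow_mul, ← zpow_natCast] at hlev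
    exact zpow_right_injective₀ hρ0 hϖ.1.ne hlev
  have hpk1 : (1 : ℤ) ≤ ((p ^ k : ℕ) : ℤ) := by exact_mod_cast Nat.one_le_pow k p hp.out.pos
  have hA1' : (1 : ℤ) ≤ (A : ℤ) := by exact_mod_cast hA1
  have hℓ1 : 1 ≤ ℓ := by nlinarith
  have hℓA' : ℓ ≤ (A : ℤ) := by nlinarith
  -- `‖p‖·‖ϖ‖^A = ‖ϖ‖^{Ap} < ‖ϖ‖^ℓ = ‖1 − ξ‖`
  have hpA : ‖(p : K)‖ * ‖(ϖ : K)‖ ^ A < ‖1 - ξ‖ := by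
    rw [norm_prime_mul_pow_level p hϖ hA, hℓ, ← zpow_natCast]
    refine zpow_lt_zpow_right_of_lt_one₀ hρ0 hϖ.1 ?_
    have hP2' : (2 : ℤ) ≤ (p : ℤ) := by exact_mod_cast hP2
    push_cast
    nlinarith
  have hup : ‖1 - v ^ p‖ = ‖1 - ξ‖ := by
    have hlt : ‖-(v ^ p - ξ)‖ < ‖1 - ξ‖ := by rw [norm_neg]; exact hv.trans_lt hpA
    have h : (1 : K) - v ^ p = (1 - ξ) + -(v ^ p - ξ) := by ring
    rw [h, norm_add_eq_max_of_norm_ne_norm (ne_of_gt hlt), max_eq_left hlt.le]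
  have hvpP : IsPrincipal (v ^ p) := by
    show ‖1 - v ^ p‖ < 1
    rw [hup, hℓ]
    exact (zpow_lt_one_iff_right_of_lt_one₀ hρ0 hϖ.1).mpr (by omega)
  have hv1 : ‖v‖ = 1 := norm_eq_one_of_isPrincipal_pow hp.out.pos hvpP
  have hvP : IsPrincipal v := IsPrincipal.of_pow_prime (p := p) hv1.le hvpP
  by_cases hlevv : ‖(ϖ : K)‖ ^ A < ‖1 - v‖
  · -- below the critical level the `p`-th power is exact: `‖ϖ‖^ℓ = ‖1 − v‖^p = ‖ϖ‖^{s·p}`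
    have h := norm_one_add_pow_prime_sub_one_eq p hϖ hA (x := v - 1) (by rwa [norm_sub_rev])
      (by rw [norm_sub_rev]; exact hvP.le)
    rw [add_sub_cancel, norm_sub_rev, hup, hℓ, norm_sub_rev] at h
    have hy : (1 : K) - v ≠ 0 := norm_pos_iff.mp ((pow_pos hρ0 _).trans hlevv)
    obtain ⟨s, hs⟩ := hϖ.2 (Units.mk0 (1 - v) hy)
    rw [Units.val_mk0] at hs
    have h2 : ‖(ϖ : K)‖ ^ ℓ = ‖(ϖ : K)‖ ^ (s * (p : ℤ)) := by
      rw [h, hs, ← zpow_natCast, ← zpow_mul]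
    have hℓs : ℓ = s * (p : ℤ) := zpow_right_injective₀ hρ0 hϖ.1.ne h2
    refine Int.natCast_dvd_natCast.mp ⟨s, ?_⟩
    rw [← hℓA, hℓs]
    push_cast
    ring
  · -- level `≥ A` would make `v^p` too deep
    push Not at hlevv
    have h := norm_one_add_pow_prime_sub_one_le_prime_mul p hϖ hA (x := v - 1) (by rwa [norm_sub_rev])
    rw [add_sub_cancel, norm_sub_rev, hup] at h
    exact absurd h (not_le.mpr hpA)

/-- **`ζ_{p^{k+1}} ∈ K` and `p^{k+1} ∤ A` ⇒ `r_in = A + 1`** (R-W format; `p` odd, `e = A(p−1)`, `ξ` any PRIMITIVE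
`p^{k+1}`-th root of unity of `K`): there is no torsion witness (§4), so by abc-iut-s2-p12's criterion
`closedBall 0 ‖ϖ‖^{A+1} ⊆ log_p(𝒪_K^×)` and `¬ closedBall 0 ‖ϖ‖^A ⊆ log_p(𝒪_K^×)` — a verdict read off `e` and the
`p`-power roots of unity of `K` alone (`k = 0`: abc-iut-c312-3's Part III `r_in = A + 1` for `ζ_p ∈ K`, `p ∤ A`).
[cite: SerreLocalFields1979, Ch. XIV §4] [cite: NeukirchANT1999, Ch. II Prop. (5.5)–(5.7)] -/
theorem innerRadius_tie_succ_of_not_pow_succ_dvd (hp2 : p ≠ 2) {ξ : K} {k : ℕ}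
    (hξ : IsPrimitiveRoot ξ (p ^ (k + 1))) (hdvd : ¬ p ^ (k + 1) ∣ A) :
    closedBall (0 : K) (‖(ϖ : K)‖ ^ (A + 1)) ⊆ logUnits K ∧
      ¬ closedBall (0 : K) (‖(ϖ : K)‖ ^ A) ⊆ logUnits K := by
  have hone : 1 < p ^ (k + 1) := Nat.one_lt_pow (Nat.succ_ne_zero k) hp.out.one_lt
  have hξ1 : ξ ≠ 1 := hξ.ne_one hone
  obtain ⟨ζ, hζ, hζ1⟩ := exists_pow_prime_eq_one_ne_one_of_ppow p hξ.pow_eq_one hξ1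
  refine innerRadius_tie_succ_of_forall_not_torsionWitness p hϖ hA hp2 hζ hζ1 fun ζ' u hT hnot => ?_
  obtain ⟨n, hn, hζ'⟩ := hT
  by_contra hle
  push Not at hle
  exact hdvd (pow_succ_dvd_level_of_torsionWitness p hϖ hA hξ hn hζ' hnot hle)

end Field

end LogEnvelope

end Literature.IUT.LogVolume

end
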